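import Summits.ABC.IUTFork.Repair.RcatGeiger
import Mathlib.RingTheory.RootsOfUnity.Lemmas
import Mathlib.RingTheory.RootsOfUnity.Complex
import Mathlib.Analysis.SpecialFunctions.Log.Summable
import Mathlib.Algebra.BigOperators.Intervals
import HarnessLib

/-!
# REPAIR-CATALOGUE row RC-327 (Geiger 2026, Lemma IV.6 / Thm V.5 display) — KERNEL PROOF of the typed classical
# proposition `RcatGeiger.ArchAvgNegative`

Record file of the abc-iut cell, D-0123(C) REPAIR-CATALOGUE (tester seat abc-iut-rcat-tst-2, «tests continue» item announced
on STATUS 2026-08-27T07:4xZ). PROOF-ONLY: no new definition; it proves the claim-tagged `Prop` typed by abc-iut-rcat-tst-7 in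
`Repair/RcatGeiger.lean` (p509240), namely Geiger's archimedean-average inequality
`A_tors(q, l) = (1/d)·∑_{j=1}^{d} ( j·log q − log|Θ_tors(q, ζ_l^j)| ) < 0` for `0 < q < 1`, `l ≥ 3` prime, `d = (l − 1)/2`
(`paper:doi-10-5281-zenodo-20541632`, Lemma IV.6 p.5 l.31–39; proof via the product identity Thm IV.4 p.5).

THE PROOF (elementary, as in the source). With `ζ = exp(2πi/l)`: (1) cyclotomic factorisation
`∏_{k<l−1} (X − ζ⁻¹^(k+1)) = ∑_{i<l} X^i` (Mathlib `X_pow_sub_C_eq_prod`), whence for real `x`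
`∏_{k<l−1} ‖1 − ζ^(k+1)·x‖ = ∑_{i<l} x^i`; (2) pairing `j ↔ l − j`: `∏_{j=1}^{d} ‖1 − ζ^j x‖·‖1 − (ζ^j)⁻¹ x‖ = ∑_{i<l} x^i`,
which is `≥ 1` for `x ≥ 0` and `= l` at `x = 1`; (3) absolute convergence of the products `∏_m (1 − z q^(m+1))(1 − z⁻¹ q^(m+1))`
(`multipliable_one_add_of_summable`), continuity/multiplicativity of the norm (`HasProd.map`) and `hasProd_prod` give
`∏_{j=1}^{d} ‖Θ_tors(q, ζ^j)‖ = √l · ∏_m (∑_{i<l} q^{(m+1)i}) ≥ 1`; (4) hence `∑_j log‖Θ_tors(q, ζ^j)‖ ≥ 0 > (∑_j j)·log q`.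

HONEST SCOPE: this establishes the CLASSICAL replacement-branch inequality as typed; it changes nothing in the catalogue's verdict
on the row (the replacement branch does not read the Θ-pilot: `RcatGeiger.archAvgNegative_dichotomy`, q-shape-blind class).
TAKES NO SIDE on [IUTchIII] Cor. 3.12 / [IUTchIV] Thm. 1.10 or on any author; nothing here asserts abc proved or refuted.
Standard axioms only.
-/

noncomputable section

open Complex Finset Filter Topology Polynomial

namespace Summit.ABC.IUTFork.Repair.RcatGeiger.ArchAvgProof

/-! ## 1. Cyclotomic identities -/

/-- `∏_{k<n} (X − C μ^(k+1)) = ∑_{i<n+1} X^i` for a primitive `(n+1)`-st root of unity `μ` (the step inside Mathlib's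
`IsPrimitiveRoot.prod_one_sub_pow_eq_order`, before evaluation). [folklore] -/
theorem prod_X_sub_C_pow_succ_eq_geom_sum {R : Type*} [CommRing R] [IsDomain R] {n : ℕ} {μ : R}
    (hμ : IsPrimitiveRoot μ (n + 1)) :
    ∏ k ∈ range n, (X - C (μ ^ (k + 1))) = ∑ i ∈ range (n + 1), (X : R[X]) ^ i := by
  have h := X_pow_sub_C_eq_prod hμ n.zero_lt_succ (one_pow (n + 1))
  simp only [mul_one] at h
  rw [C_1, ← mul_geom_sum, prod_range_succ', pow_zero, C_1, mul_comm] at h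
  -- h : (∑ i ∈ range (n+1), X^i) * (X - 1) = (∏ k ∈ range n, (X - C (μ ^ (k + 1)))) * (X - 1)
  have hne : (X : R[X]) - 1 ≠ 0 := by simpa [C_1] using X_sub_C_ne_zero (1 : R)
  exact (mul_right_cancel₀ hne h).symm

/-- For a primitive `(n+1)`-st root of unity `ζ ∈ ℂ` and a real `x`:  `∏_{k<n} ‖1 − ζ^(k+1)·x‖ = |∑_{i<n+1} x^i|`
(pass to `ζ⁻¹`, also primitive, and evaluate `prod_X_sub_C_pow_succ_eq_geom_sum` at `x`). [folklore] -/
theorem prod_norm_one_sub_pow_mul {n : ℕ} {ζ : ℂ} (hζ : IsPrimitiveRoot ζ (n + 1)) (x : ℝ) :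
    ∏ k ∈ range n, ‖1 - ζ ^ (k + 1) * (x : ℂ)‖ = |∑ i ∈ range (n + 1), x ^ i| := by
  have hζ0 : ζ ≠ 0 := hζ.ne_zero (Nat.succ_ne_zero n)
  have hn1 : ‖ζ‖ = 1 := hζ.norm'_eq_one (Nat.succ_ne_zero n)
  have hterm : ∀ k : ℕ, ‖1 - ζ ^ (k + 1) * (x : ℂ)‖ = ‖(x : ℂ) - (ζ⁻¹) ^ (k + 1)‖ := by
    intro k
    have : (1 : ℂ) - ζ ^ (k + 1) * (x : ℂ) = ζ ^ (k + 1) * ((ζ⁻¹) ^ (k + 1) - (x : ℂ)) := by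
      rw [mul_sub, ← mul_pow, mul_inv_cancel₀ hζ0, one_pow]
    rw [this, norm_mul, norm_pow, hn1, one_pow, one_mul, norm_sub_rev]
  simp_rw [hterm]
  rw [← norm_prod]
  have hpoly := prod_X_sub_C_pow_succ_eq_geom_sum hζ.inv
  have heval := congrArg (Polynomial.eval (x : ℂ)) hpoly
  simp only [eval_prod, eval_sub, eval_X, eval_C, eval_finsetSum, eval_pow] at heval
  rw [heval]
  have : (∑ i ∈ range (n + 1), (x : ℂ) ^ i) = ((∑ i ∈ range (n + 1), x ^ i : ℝ) : ℂ) := by push_cast; rfl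
  rw [this, Complex.norm_real, Real.norm_eq_abs]

/-- The same sum is `≥ 1` for `0 ≤ x`. [folklore] -/
theorem one_le_geom_sum_of_nonneg {x : ℝ} (hx : 0 ≤ x) (n : ℕ) : 1 ≤ ∑ i ∈ range (n + 1), x ^ i := by
  rw [sum_range_succ']
  simp only [pow_zero]
  have : 0 ≤ ∑ i ∈ range n, x ^ (i + 1) := sum_nonneg fun i _ => pow_nonneg hx _
  linarith

/-! ## 2. Pairing `j ↔ l − j` -/

/-- `∏_{j ∈ Icc 1 d} g j = ∏_{k<d} g (k+1)`. [folklore] -/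
theorem prod_Icc_one_eq_prod_range {M : Type*} [CommMonoid M] (g : ℕ → M) (d : ℕ) :
    ∏ j ∈ Icc 1 d, g j = ∏ k ∈ range d, g (k + 1) := by
  rw [← Finset.Ico_add_one_right_eq_Icc, prod_Ico_eq_prod_range]
  simp only [Nat.add_sub_cancel]
  exact prod_congr rfl fun k _ => by rw [add_comm]

/-- For `l = 2d + 1`: `∏_{k<2d} f (k+1) = ∏_{j ∈ Icc 1 d} f j · ∏_{j ∈ Icc 1 d} f (l − j)`. [folklore] -/
theorem prod_range_two_mul_succ_eq {M : Type*} [CommMonoid M] (f : ℕ → M) (d : ℕ) :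
    ∏ k ∈ range (2 * d), f (k + 1) = (∏ j ∈ Icc 1 d, f j) * ∏ j ∈ Icc 1 d, f (2 * d + 1 - j) := by
  rw [prod_Icc_one_eq_prod_range, prod_Icc_one_eq_prod_range, two_mul, prod_range_add]
  congr 1
  rw [← prod_range_reflect (fun k => f (d + d + 1 - (k + 1))) d]
  refine prod_congr rfl fun k hk => ?_
  have hk' := mem_range.mp hk
  congr 1
  omega

/-! ## 3. The infinite products `∏_m (1 − z q^(m+1))(1 − z⁻¹ q^(m+1))` -/

/-- Absolute convergence: for `0 ≤ q < 1` and `‖z‖ = 1` the product `∏_m (1 − z q^(m+1))(1 − z⁻¹ q^(m+1))` is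
multipliable (its `m`-th factor is `1 + a_m` with `‖a_m‖ ≤ 3 q^(m+1)`). [folklore] -/
theorem multipliable_thetaFactor {q : ℝ} (hq0 : 0 ≤ q) (hq1 : q < 1) {z : ℂ} (hz : ‖z‖ = 1) :
    Multipliable fun m : ℕ => (1 - z * (q : ℂ) ^ (m + 1)) * (1 - z⁻¹ * (q : ℂ) ^ (m + 1)) := by
  have hfun : (fun m : ℕ => (1 - z * (q : ℂ) ^ (m + 1)) * (1 - z⁻¹ * (q : ℂ) ^ (m + 1)))
      = fun m : ℕ => 1 + (-(z + z⁻¹) * (q : ℂ) ^ (m + 1) + z * z⁻¹ * ((q : ℂ) ^ (m + 1)) ^ 2) := by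
    funext m; ring
  rw [hfun]
  apply multipliable_one_add_of_summable
  have hgeo : Summable fun m : ℕ => 3 * q * q ^ m := (summable_geometric_of_lt_one hq0 hq1).mul_left (3 * q)
  refine Summable.of_nonneg_of_le (fun _ => norm_nonneg _) (fun m => ?_) hgeo
  have hxq : ‖(q : ℂ) ^ (m + 1)‖ = q ^ (m + 1) := by
    rw [norm_pow, Complex.norm_real, Real.norm_eq_abs, abs_of_nonneg hq0]
  have hzi : ‖z⁻¹‖ = 1 := by rw [norm_inv, hz, inv_one]
  have hqm : q ^ (m + 1) ≤ 1 := pow_le_one₀ hq0 hq1.le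
  have hqm0 : 0 ≤ q ^ (m + 1) := pow_nonneg hq0 _
  calc ‖-(z + z⁻¹) * (q : ℂ) ^ (m + 1) + z * z⁻¹ * ((q : ℂ) ^ (m + 1)) ^ 2‖
      ≤ ‖-(z + z⁻¹) * (q : ℂ) ^ (m + 1)‖ + ‖z * z⁻¹ * ((q : ℂ) ^ (m + 1)) ^ 2‖ := norm_add_le _ _
    _ ≤ 2 * q ^ (m + 1) + 1 * (q ^ (m + 1)) ^ 2 := by
        gcongr
        · rw [norm_mul, norm_neg, hxq]
          gcongr
          calc ‖z + z⁻¹‖ ≤ ‖z‖ + ‖z⁻¹‖ := norm_add_le _ _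
            _ = 2 := by rw [hz, hzi]; norm_num
        · rw [norm_mul, norm_mul, norm_pow, hxq, hz, hzi, one_mul]
    _ ≤ 2 * q ^ (m + 1) + 1 * q ^ (m + 1) := by nlinarith
    _ = 3 * q * q ^ m := by ring

/-- The norm of a convergent product is the product of the norms. [folklore] -/
theorem hasProd_norm_of_multipliable {f : ℕ → ℂ} (hf : Multipliable f) :
    HasProd (fun m => ‖f m‖) ‖∏' m, f m‖ := by
  have h := hf.hasProd.map (normHom : ℂ →*₀ ℝ) continuous_norm
  exact h

/-! ## 4. The finite identities over `j ∈ Icc 1 d` -/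

/-- For a primitive `(2d+1)`-st root `ζ` and real `x`:
`∏_{j=1}^{d} ‖1 − ζ^j x‖·‖1 − (ζ^j)⁻¹ x‖ = |∑_{i<2d+1} x^i|` (pairing + cyclotomic identity). [folklore] -/
theorem prod_Icc_norm_pair_eq {d : ℕ} {ζ : ℂ} (hζ : IsPrimitiveRoot ζ (2 * d + 1)) (x : ℝ) :
    ∏ j ∈ Icc 1 d, (‖1 - ζ ^ j * (x : ℂ)‖ * ‖1 - (ζ ^ j)⁻¹ * (x : ℂ)‖)
      = |∑ i ∈ range (2 * d + 1), x ^ i| := by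
  have hinv : ∀ j ∈ Icc 1 d, (ζ ^ j)⁻¹ = ζ ^ (2 * d + 1 - j) := by
    intro j hj
    have hj' : j ≤ 2 * d + 1 := by have := (mem_Icc.mp hj).2; omega
    apply inv_eq_of_mul_eq_one_right
    rw [← pow_add, Nat.add_sub_cancel' hj', hζ.pow_eq_one]
  have h2 : ∏ j ∈ Icc 1 d, ‖1 - (ζ ^ j)⁻¹ * (x : ℂ)‖ = ∏ j ∈ Icc 1 d, ‖1 - ζ ^ (2 * d + 1 - j) * (x : ℂ)‖ :=
    prod_congr rfl fun j hj => by rw [hinv j hj]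
  rw [prod_mul_distrib, h2, ← prod_range_two_mul_succ_eq (fun i => ‖1 - ζ ^ i * (x : ℂ)‖) d]
  exact prod_norm_one_sub_pow_mul hζ x

/-- In particular (`x = 1`, using `‖1 − w⁻¹‖ = ‖1 − w‖` for `‖w‖ = 1`): `(∏_{j=1}^{d} ‖1 − ζ^j‖)² = 2d + 1`,
hence `∏_{j=1}^{d} ‖1 − ζ^j‖ ≥ 1`. [folklore] -/
theorem one_le_prod_Icc_norm_one_sub_pow {d : ℕ} {ζ : ℂ} (hζ : IsPrimitiveRoot ζ (2 * d + 1)) :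
    1 ≤ ∏ j ∈ Icc 1 d, ‖1 - ζ ^ j‖ := by
  have hn1 : ‖ζ‖ = 1 := hζ.norm'_eq_one (Nat.succ_ne_zero _)
  have hζ0 : ζ ≠ 0 := hζ.ne_zero (Nat.succ_ne_zero _)
  have hsame : ∀ j : ℕ, ‖1 - (ζ ^ j)⁻¹ * ((1 : ℝ) : ℂ)‖ = ‖1 - ζ ^ j‖ := by
    intro j
    have hw0 : ζ ^ j ≠ 0 := pow_ne_zero _ hζ0
    have : (1 : ℂ) - (ζ ^ j)⁻¹ * ((1 : ℝ) : ℂ) = (ζ ^ j)⁻¹ * (ζ ^ j - 1) := by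
      rw [Complex.ofReal_one, mul_one, mul_sub, inv_mul_cancel₀ hw0, mul_one]
    rw [this, norm_mul, norm_inv, norm_pow, hn1, one_pow, inv_one, one_mul, norm_sub_rev]
  have hsq := prod_Icc_norm_pair_eq hζ 1
  simp only [one_pow, sum_const, card_range] at hsq
  -- hsq : ∏ j ∈ Icc 1 d, ‖1 - ζ ^ j * ↑1‖ * ‖1 - (ζ ^ j)⁻¹ * ↑1‖ = |(2d+1 : ℝ)|
  have h1 : ∀ j : ℕ, ‖1 - ζ ^ j * ((1 : ℝ) : ℂ)‖ = ‖1 - ζ ^ j‖ := by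
    intro j; rw [Complex.ofReal_one, mul_one]
  simp_rw [h1, hsame] at hsq
  rw [prod_mul_distrib] at hsq
  have hP0 : 0 ≤ ∏ j ∈ Icc 1 d, ‖1 - ζ ^ j‖ := prod_nonneg fun j _ => norm_nonneg _
  have hd0 : (0 : ℝ) ≤ d := Nat.cast_nonneg d
  have hge : (1 : ℝ) ≤ (∏ j ∈ Icc 1 d, ‖1 - ζ ^ j‖) * ∏ j ∈ Icc 1 d, ‖1 - ζ ^ j‖ := by
    rw [hsq]
    refine le_abs.mpr (Or.inl ?_)
    simp only [nsmul_eq_mul, mul_one]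
    push_cast
    linarith
  nlinarith

/-! ## 5. Assembly: `∏_{j=1}^{d} ‖Θ_tors(q, ζ^j)‖ ≥ 1` and the inequality -/

/-- The product over the labels `j = 1 … d` of the norms of the torsion-normalised theta values is `≥ 1`
(`= √(2d+1) · ∏_m ∑_{i<2d+1} q^{(m+1)i}`). [folklore] -/
theorem one_le_prod_norm_thetaTors {q : ℝ} (hq0 : 0 < q) (hq1 : q < 1) {d : ℕ} {ζ : ℂ}
    (hζ : IsPrimitiveRoot ζ (2 * d + 1)) :
    1 ≤ ∏ j ∈ Icc 1 d, ‖thetaTors q (ζ ^ j)‖ := by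
  have hn1 : ‖ζ‖ = 1 := hζ.norm'_eq_one (Nat.succ_ne_zero _)
  -- the Euler factors and their norms
  set g : ℕ → ℕ → ℂ := fun j m => (1 - ζ ^ j * (q : ℂ) ^ (m + 1)) * (1 - (ζ ^ j)⁻¹ * (q : ℂ) ^ (m + 1))
    with hg
  have hmult : ∀ j : ℕ, Multipliable (g j) := fun j =>
    multipliable_thetaFactor hq0.le hq1 (z := ζ ^ j) (by rw [norm_pow, hn1, one_pow])
  have hnormg : ∀ (j m : ℕ), ‖g j m‖
      = ‖1 - ζ ^ j * ((q ^ (m + 1) : ℝ) : ℂ)‖ * ‖1 - (ζ ^ j)⁻¹ * ((q ^ (m + 1) : ℝ) : ℂ)‖ := by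
    intro j m; rw [hg]; push_cast; rw [norm_mul]
  -- the product over j of the norms of the m-th factors is the geometric sum, hence ≥ 1
  have hP : ∀ m : ℕ, 1 ≤ ∏ j ∈ Icc 1 d, ‖g j m‖ := by
    intro m
    simp_rw [hnormg]
    rw [prod_Icc_norm_pair_eq hζ (q ^ (m + 1))]
    exact (one_le_geom_sum_of_nonneg (pow_nonneg hq0.le _) (2 * d)).trans (le_abs_self _)
  -- HasProd for the j-product of the norms, with limit ∏_j ‖∏' m, g j m‖
  have hH : HasProd (fun m => ∏ j ∈ Icc 1 d, ‖g j m‖) (∏ j ∈ Icc 1 d, ‖∏' m, g j m‖) :=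
    hasProd_prod fun j _ => hasProd_norm_of_multipliable (hmult j)
  have hpartial : ∀ n : ℕ, (1 : ℝ) ≤ ∏ m ∈ range n, ∏ j ∈ Icc 1 d, ‖g j m‖ := by
    intro n
    induction n with
    | zero => simp
    | succ n ih =>
      rw [prod_range_succ]
      nlinarith [hP n, ih]
  have hV : (1 : ℝ) ≤ ∏ j ∈ Icc 1 d, ‖∏' m, g j m‖ :=
    ge_of_tendsto' hH.tendsto_prod_nat hpartial
  -- ∏_j ‖1 − ζ^j‖ ≥ 1
  have hU : (1 : ℝ) ≤ ∏ j ∈ Icc 1 d, ‖1 - ζ ^ j‖ := one_le_prod_Icc_norm_one_sub_pow hζ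
  have hU0 : (0 : ℝ) ≤ ∏ j ∈ Icc 1 d, ‖1 - ζ ^ j‖ := prod_nonneg fun j _ => norm_nonneg _
  -- assemble
  have hsplit : ∏ j ∈ Icc 1 d, ‖thetaTors q (ζ ^ j)‖
      = (∏ j ∈ Icc 1 d, ‖1 - ζ ^ j‖) * ∏ j ∈ Icc 1 d, ‖∏' m, g j m‖ := by
    rw [← prod_mul_distrib]
    refine prod_congr rfl fun j _ => ?_
    rw [thetaTors, norm_mul]
  rw [hsplit]
  nlinarith

/-- **GEIGER'S LEMMA IV.6 / THM V.5 DISPLAY, PROVED**: the typed classical proposition `ArchAvgNegative` of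
`Repair/RcatGeiger.lean` holds — for `0 < q < 1` and every prime `l ≥ 3`, `A_tors(q, l) < 0`.
[cite: Geiger2026Cor312Gap, Lemma IV.6 p.5 l.31–39; Thm V.5 p.7 l.128–135] -/
theorem archAvgNegative_holds : ArchAvgNegative := by
  intro q hq0 hq1 l hl h3
  obtain ⟨d, hd⟩ : ∃ d, l = 2 * d + 1 := hl.odd_of_ne_two (by omega)
  have hd1 : 1 ≤ d := by omega
  have hdl : (l - 1) / 2 = d := by omega
  set ζ : ℂ := Complex.exp (2 * Real.pi * Complex.I / l) with hζdef
  have hζ : IsPrimitiveRoot ζ l := Complex.isPrimitiveRoot_exp l (by omega)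
  have hζ' : IsPrimitiveRoot ζ (2 * d + 1) := hd ▸ hζ
  have hexp : ∀ j : ℕ, Complex.exp (2 * Real.pi * Complex.I * (j : ℂ) / (l : ℂ)) = ζ ^ j := by
    intro j
    rw [hζdef, ← Complex.exp_nat_mul]
    congr 1
    ring
  unfold archAvg
  rw [hdl]
  simp_rw [hexp]
  have hdpos : (0 : ℝ) < (d : ℝ) := by exact_mod_cast hd1
  apply div_neg_of_neg_of_pos _ hdpos
  rw [sum_sub_distrib]
  -- the q-side: ∑ j·log q < 0
  have hlogq : Real.log q < 0 := Real.log_neg hq0 hq1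
  have hA : ∑ j ∈ Icc 1 d, ((j : ℝ) * Real.log q) < 0 := by
    apply sum_neg
    · intro j hj
      have hj1 : (1 : ℝ) ≤ j := by exact_mod_cast (mem_Icc.mp hj).1
      nlinarith
    · exact ⟨1, by simp [hd1]⟩
  -- the Θ-side: ∑ log‖Θ_tors‖ ≥ 0
  have hprod := one_le_prod_norm_thetaTors hq0 hq1 hζ'
  have hne : ∀ j ∈ Icc 1 d, ‖thetaTors q (ζ ^ j)‖ ≠ 0 := by
    have h0 : ∏ j ∈ Icc 1 d, ‖thetaTors q (ζ ^ j)‖ ≠ 0 := by linarith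
    exact prod_ne_zero_iff.mp h0
  have hB : 0 ≤ ∑ j ∈ Icc 1 d, Real.log ‖thetaTors q (ζ ^ j)‖ := by
    rw [← Real.log_prod hne]
    exact Real.log_nonneg hprod
  linarith

end Summit.ABC.IUTFork.Repair.RcatGeiger.ArchAvgProof

/-- Re-export at the row's namespace: `Summit.ABC.IUTFork.Repair.RcatGeiger.archAvgNegative_holds`. [folklore] -/
theorem Summit.ABC.IUTFork.Repair.RcatGeiger.archAvgNegative_holds :
    Summit.ABC.IUTFork.Repair.RcatGeiger.ArchAvgNegative :=
  Summit.ABC.IUTFork.Repair.RcatGeiger.ArchAvgProof.archAvgNegative_holds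

end
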